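import Summits.Ventures.QEC.Thresholds.ToricCodeHGP
import Summits.Ventures.QEC.Thresholds.CSSFamilyThresholds
import Literature.InformationTheory.QuantumCodes.ToricCodeErasureHalf
import Literature.InformationTheory.QuantumCodes.ToricCodeDistance
import Literature.InformationTheory.QuantumCodes.CSSEquivalenceNoise
import HarnessLib

/-!
# The census toric family `HGP(circ_L, circ_L)` IS the lattice toric code, re-indexed — hence `[[2L², 2, L]]` for
# EVERY `L` and loss threshold EXACTLY `1/2` for the census object

Venture QEC, `Summits/Ventures/QEC/Thresholds/` (LADDER-QEC rungs Q4/Q5; qec-type-03 gen 5, cell item 03.TORHGP). All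
PROVED, kernel axioms, no named fact, no `native_decide`. Two toric-code objects live in the tree: type-09's census /
threshold object `toricHGPCode k = HGP.code (cycMatrix k) (cycMatrix k)` (`ToricCodeHGP.lean`; `L = k + 2`; qubits
`(Fin L × Fin L) ⊕ (Fin L × Fin L)`, CENSUS-PREREG cell B.0, Q5 rows F4/F5) and lit-2's lattice object
`ToricCode.toricCode L` (`ToricCodeThreshold.lean`; links `ℤ_L² × {0,1}`, stars / plaquettes; the DKLP object of all the
self-avoiding-walk threshold theorems and of the EXACT loss threshold `ToricCode.erasure_accuracyThreshold_eq_half`).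
This file identifies them by an explicit re-indexing ("FACT P", `CSSCode.eq_reindex_of_submatrix`):

* sites `(a, b) ↦ (a, −b)` (`toricVertexEquiv`), left qubits `(j, b) ↦ ((j, −b), 0)`, right qubits
  `(a, c) ↦ ((a, −c), 1)` (`toricQubitEquiv`); then `H^X_{HGP} = H^X_{lattice} ∘ (sites × qubits)` and the same for
  `H^Z` (`toricHGPCode_HX_eq_starMatrix_submatrix`, `toricHGPCode_HZ_eq_plaquetteMatrix_submatrix`), i.e.
  **`toricHGPCode_eq_reindex : toricHGPCode k = (toricCode (k+2)).reindex …`**;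
* consequences by transport: `toricHGPCode_dZ_eq` / `toricHGPCode_dX_eq` (`d^Z = d^X = L` EXACTLY for every `L` —
  `ToricCodeHGP.lean` had only `≥ L` parametrically and equality size by size), `toricCode_k_eq_two` (lattice object:
  `k = 2`, transported back from Tillich–Zémor Thm 7), **`toricHGPCode_isCode : (toricHGPCode k).IsCode (2(k+2)²) 2 (k+2)`**
  and `toricCode_isCode` — the census B.0 family `[[2L², 2, L]]` as ONE kernel theorem for every `L ≥ 2`;
* loss thresholds of the CENSUS object: `toricHGP_zErasureFamily_eq_erasureFamily` / `toricHGP_xErasureFamily_eq_erasureFamily` (its sector erasure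
  families are the lattice loss family shifted by one index) and ★ `toricHGP_z_erasure_accuracyThreshold_eq_half`,
  `toricHGP_x_erasure_accuracyThreshold_eq_half`: **loss threshold EXACTLY `1/2`** for `HGP(circ_L, circ_L)`, both sectors
  (the Q5 row F4 interval `1/3 ≤ y_c ≤ 1/2` becomes the exact value).

## References

* [KovalevPryadko2012] A. A. Kovalev, L. P. Pryadko, ISIT 2012 = arXiv:1202.0928, Examples 2 and 6 (toric codes
  `[[2d², 2, d]]` as hypergraph products of circulant matrices).
* [DennisEtAl2002] Dennis–Kitaev–Landahl–Preskill, J. Math. Phys. 43 (2002) 4452, §3.1 (the `L × L` toric code: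
  `2L²` links, `k = 2`, `d = L`).
* [StaceBarrettDoherty2009] Stace–Barrett–Doherty, PRL 102 (2009) 200501, p. 1–3 (loss threshold `0.5`).
* [LinPryadko2024] H.-K. Lin, L. P. Pryadko, §4.2 Thm 6 (permutation-equivalent CSS codes share all parameters).
-/

noncomputable section

namespace Summit.Ventures.QEC.Thresholds

open Matrix Filter Topology
open Literature.InformationTheory.QuantumCodes
open Literature.InformationTheory.QuantumCodes.ToricCode

/-! ### The re-indexing maps -/

/-- `Fin (k+2)` read in `ℤ_{k+2}` (the identity map: `ZMod (k+2)` unfolds to `Fin (k+2)`). [folklore] -/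
def toZ (k : ℕ) (a : Fin (k + 2)) : ZMod (k + 2) := a

/-- `toZ` is injective (it is the identity). [folklore] -/
@[simp] theorem toZ_inj {k : ℕ} {a b : Fin (k + 2)} : toZ k a = toZ k b ↔ a = b := Iff.rfl

/-- `toZ` commutes with `+ 1`. [folklore] -/
theorem toZ_add_one {k : ℕ} (a : Fin (k + 2)) : toZ k a + 1 = toZ k (a + 1) := rfl

/-- `toZ` commutes with `- 1`. [folklore] -/
theorem toZ_sub_one {k : ℕ} (a : Fin (k + 2)) : toZ k a - 1 = toZ k (a - 1) := rfl

/-- `toZ` commutes with negation. [folklore] -/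
theorem neg_toZ {k : ℕ} (a : Fin (k + 2)) : -toZ k a = toZ k (-a) := rfl

/-- **Site map**: the HGP check index `(a, b)` is the lattice site `(a, −b)`. [cite: KovalevPryadko2012, Example 6 (toric code as HGP of circulants)] -/
def toricVertexEquiv (k : ℕ) : Fin (k + 2) × Fin (k + 2) ≃ Vertex (k + 2) where
  toFun ab := ![toZ k ab.1, -toZ k ab.2]
  invFun v := (v 0, -v 1)
  left_inv ab := by
    obtain ⟨a, b⟩ := ab
    simp [toZ]
  right_inv v := by
    funext i
    fin_cases i <;> simp [toZ]

/-- The site map in coordinates. [cite: KovalevPryadko2012, Example 6] -/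
@[simp] theorem toricVertexEquiv_apply (k : ℕ) (a b : Fin (k + 2)) :
    toricVertexEquiv k (a, b) = ![toZ k a, -toZ k b] := rfl

/-- **Qubit map**: left qubits `(j, b)` are the horizontal links `((j, −b), 0)`, right qubits `(a, c)` the vertical links
`((a, −c), 1)`. [cite: KovalevPryadko2012, Example 6 (toric code as HGP of circulants)] -/
def toricQubitEquiv (k : ℕ) :
    ((Fin (k + 2) × Fin (k + 2)) ⊕ (Fin (k + 2) × Fin (k + 2))) ≃ Edge (k + 2) where
  toFun q := Sum.elim (fun jb => (toricVertexEquiv k jb, (0 : Fin 2))) (fun ac => (toricVertexEquiv k ac, (1 : Fin 2))) q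
  invFun ℓ := if ℓ.2 = 0 then Sum.inl ((toricVertexEquiv k).symm ℓ.1) else Sum.inr ((toricVertexEquiv k).symm ℓ.1)
  left_inv q := by
    rcases q with jb | ac <;> simp
  right_inv ℓ := by
    obtain ⟨v, i⟩ := ℓ
    fin_cases i <;> simp

/-- The qubit map on left qubits. [cite: KovalevPryadko2012, Example 6] -/
@[simp] theorem toricQubitEquiv_inl (k : ℕ) (j b : Fin (k + 2)) :
    toricQubitEquiv k (Sum.inl (j, b)) = (![toZ k j, -toZ k b], 0) := rfl

/-- The qubit map on right qubits. [cite: KovalevPryadko2012, Example 6] -/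
@[simp] theorem toricQubitEquiv_inr (k : ℕ) (a c : Fin (k + 2)) :
    toricQubitEquiv k (Sum.inr (a, c)) = (![toZ k a, -toZ k c], 1) := rfl

/-! ### Entries of the lattice check matrices -/

variable {L : ℕ}

/-- Two sites agree iff both coordinates agree. [folklore] -/
theorem vec2_eq_iff (x y x' y' : ZMod L) : (![x, y] : Vertex L) = ![x', y'] ↔ x = x' ∧ y = y' := by
  constructor
  · intro h
    exact ⟨by simpa using congrFun h 0, by simpa using congrFun h 1⟩
  · rintro ⟨rfl, rfl⟩
    rfl

/-- `(x, y) − e₀ = (x − 1, y)`. [folklore] -/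
theorem vec2_sub_dir_zero (x y : ZMod L) : (![x, y] : Vertex L) - dir 0 = ![x - 1, y] := by
  funext i; fin_cases i <;> simp [dir]

/-- `(x, y) − e₁ = (x, y − 1)`. [folklore] -/
theorem vec2_sub_dir_one (x y : ZMod L) : (![x, y] : Vertex L) - dir 1 = ![x, y - 1] := by
  funext i; fin_cases i <;> simp [dir]

/-- `(x, y) + e₀ = (x + 1, y)`. [folklore] -/
theorem vec2_add_dir_zero (x y : ZMod L) : (![x, y] : Vertex L) + dir 0 = ![x + 1, y] := by
  funext i; fin_cases i <;> simp [dir]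

/-- `(x, y) + e₁ = (x, y + 1)`. [folklore] -/
theorem vec2_add_dir_one (x y : ZMod L) : (![x, y] : Vertex L) + dir 1 = ![x, y + 1] := by
  funext i; fin_cases i <;> simp [dir]

/-- Star entries on horizontal links: `H^X(s, (v,0)) = [v = s] + [v = s − e₀]`. [cite: DennisEtAl2002, §3.1 (X_s on the four links meeting s)] -/
theorem starMatrix_apply_fst (s v : Vertex L) :
    starMatrix L s (v, 0) = (if v = s then 1 else 0) + (if v = s - dir 0 then 1 else 0) := by
  simp [starMatrix, starRow, Pi.single_apply]

/-- Star entries on vertical links: `H^X(s, (v,1)) = [v = s] + [v = s − e₁]`. [cite: DennisEtAl2002, §3.1] -/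
theorem starMatrix_apply_snd (s v : Vertex L) :
    starMatrix L s (v, 1) = (if v = s then 1 else 0) + (if v = s - dir 1 then 1 else 0) := by
  simp [starMatrix, starRow, Pi.single_apply]

/-- Plaquette entries on horizontal links: `H^Z(w, (v,0)) = [v = w] + [v = w + e₁]`. [cite: DennisEtAl2002, §3.1 (Z_P on the four links bounding P)] -/
theorem plaquetteMatrix_apply_fst (w v : Vertex L) :
    plaquetteMatrix L w (v, 0) = (if v = w then 1 else 0) + (if v = w + dir 1 then 1 else 0) := by
  simp [plaquetteMatrix, plaquetteRow, Pi.single_apply]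

/-- Plaquette entries on vertical links: `H^Z(w, (v,1)) = [v = w] + [v = w + e₀]`. [cite: DennisEtAl2002, §3.1] -/
theorem plaquetteMatrix_apply_snd (w v : Vertex L) :
    plaquetteMatrix L w (v, 1) = (if v = w then 1 else 0) + (if v = w + dir 0 then 1 else 0) := by
  simp [plaquetteMatrix, plaquetteRow, Pi.single_apply]

/-- The two-neighbour indicator of the cycle code in `ℤ₂`: `[j = a ∨ j + 1 = a] = [j = a] + [j + 1 = a]` (the two cases
exclude each other since `1 ≠ 0` in `Fin (k+2)`). [cite: KovalevPryadko2012, Example 2 (circulant repetition checks)] -/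
theorem ite_or_eq_add {k : ℕ} (j a : Fin (k + 2)) :
    (if j = a ∨ j + 1 = a then (1 : ZMod 2) else 0) = (if j = a then 1 else 0) + (if j + 1 = a then 1 else 0) := by
  by_cases h1 : j = a
  · subst h1
    have h2 : ¬ j + 1 = j := by
      intro h
      have h' : (1 : Fin (k + 2)) = 0 := add_eq_left.mp h
      exact absurd h' (ne_of_gt Fin.zero_lt_one)
    simp [h2]
  · by_cases h2 : j + 1 = a <;> simp [h1, h2]

/-! ### The check matrices agree along the re-indexing -/

/-- `-c = -b - d ↔ b + d = c` in an additive commutative group. [folklore] -/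
theorem neg_eq_neg_sub_iff {G : Type*} [AddCommGroup G] (b c d : G) : -c = -b - d ↔ b + d = c := by
  rw [← neg_add', neg_inj]
  exact eq_comm

/-- `-b = -c + d ↔ b + d = c` in an additive commutative group. [folklore] -/
theorem neg_eq_neg_add_iff {G : Type*} [AddCommGroup G] (b c d : G) : -b = -c + d ↔ b + d = c := by
  rw [neg_add_eq_sub, ← neg_sub, neg_inj, eq_sub_iff_add_eq]

/-- **`H^X` of `HGP(circ_L, circ_L)` is the star matrix of the lattice toric code re-indexed.**
[cite: KovalevPryadko2012, Example 6 (toric codes as HGP(circ, circ))] -/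
theorem toricHGPCode_HX_eq_starMatrix_submatrix (k : ℕ) :
    (toricHGPCode k).HX = (starMatrix (k + 2)).submatrix (toricVertexEquiv k) (toricQubitEquiv k) := by
  ext ⟨a, b⟩ q
  rw [Matrix.submatrix_apply, toricVertexEquiv_apply]
  change HGP.HX (cycMatrix k) (cycMatrix k) (a, b) q = _
  rcases q with ⟨j, b'⟩ | ⟨a', c⟩
  · rw [HGP.HX, HypergraphProduct.xMatrix_apply_inl, toricQubitEquiv_inl, starMatrix_apply_fst, vec2_sub_dir_zero]
    simp only [vec2_eq_iff, toZ_sub_one, neg_toZ, toZ_inj, neg_inj, cycMatrix, Matrix.of_apply, ite_or_eq_add,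
      eq_sub_iff_add_eq]
    by_cases hb : b = b'
    · subst hb
      simp
    · have hb' : ¬ b' = b := fun h => hb h.symm
      simp [hb, hb']
  · rw [HGP.HX, HypergraphProduct.xMatrix_apply_inr, Matrix.transpose_apply, toricQubitEquiv_inr,
      starMatrix_apply_snd, vec2_sub_dir_one]
    simp only [vec2_eq_iff, neg_toZ, toZ_sub_one, toZ_inj, neg_inj, neg_eq_neg_sub_iff, cycMatrix,
      Matrix.of_apply, ite_or_eq_add]
    by_cases ha : a = a'
    · subst ha
      rcases eq_or_ne b c with rfl | hbc
      · simp
      · have hcb : ¬ c = b := fun h => hbc h.symm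
        simp [hbc, hcb]
    · have ha' : ¬ a' = a := fun h => ha h.symm
      simp [ha, ha']

/-- **`H^Z` of `HGP(circ_L, circ_L)` is the plaquette matrix of the lattice toric code re-indexed.**
[cite: KovalevPryadko2012, Example 6 (toric codes as HGP(circ, circ))] -/
theorem toricHGPCode_HZ_eq_plaquetteMatrix_submatrix (k : ℕ) :
    (toricHGPCode k).HZ = (plaquetteMatrix (k + 2)).submatrix (toricVertexEquiv k) (toricQubitEquiv k) := by
  ext ⟨j, c⟩ q
  rw [Matrix.submatrix_apply, toricVertexEquiv_apply]
  change HGP.HZ (cycMatrix k) (cycMatrix k) (j, c) q = _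
  rcases q with ⟨j', b⟩ | ⟨a, c'⟩
  · rw [HGP.HZ, HypergraphProduct.zMatrix_apply_inl, Matrix.transpose_apply, toricQubitEquiv_inl,
      plaquetteMatrix_apply_fst, vec2_add_dir_one]
    simp only [vec2_eq_iff, neg_toZ, toZ_add_one, toZ_inj, neg_inj, neg_eq_neg_add_iff, cycMatrix,
      Matrix.of_apply, ite_or_eq_add]
    by_cases hj : j = j'
    · subst hj
      rcases eq_or_ne b c with rfl | hbc
      · simp
      · simp [hbc]
    · have hj' : ¬ j' = j := fun h => hj h.symm
      simp [hj, hj']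
  · rw [HGP.HZ, HypergraphProduct.zMatrix_apply_inr, toricQubitEquiv_inr, plaquetteMatrix_apply_snd,
      vec2_add_dir_zero]
    simp only [vec2_eq_iff, neg_toZ, toZ_add_one, toZ_inj, neg_inj, cycMatrix, Matrix.of_apply, ite_or_eq_add]
    have e1 : a = j + 1 ↔ j + 1 = a := eq_comm
    by_cases hc : c = c'
    · subst hc
      by_cases h1 : j = a
      · subst h1
        simp [e1]
      · have h1' : ¬ a = j := fun h => h1 h.symm
        simp [h1, h1', e1]
    · have hc' : ¬ c' = c := fun h => hc h.symm
      simp [hc, hc']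

/-! ### The identification and the transported parameters -/

/-- ★ **`HGP(circ_L, circ_L)` IS the lattice toric code re-indexed** (`L = k + 2`).
[cite: KovalevPryadko2012, Examples 2 and 6 (toric codes as hypergraph products of circulant matrices)] -/
theorem toricHGPCode_eq_reindex (k : ℕ) :
    toricHGPCode k = (toricCode (k + 2)).reindex (toricVertexEquiv k).symm (toricVertexEquiv k).symm
      (toricQubitEquiv k).symm :=
  CSSCode.eq_reindex_of_submatrix (C := toricCode (k + 2)) (toricHGPCode_HX_eq_starMatrix_submatrix k)
    (toricHGPCode_HZ_eq_plaquetteMatrix_submatrix k)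

/-- **`d^Z = L` EXACTLY for the census toric object, every `L`** (transported from `ToricCode.toricCode_dZ`).
[cite: DennisEtAl2002, §3.1 ("the code distance is d = L")] -/
theorem toricHGPCode_dZ_eq (k : ℕ) : (toricHGPCode k).dZ = k + 2 := by
  rw [CSSCode.dZ_eq_of_submatrix (C := toricCode (k + 2)) (toricHGPCode_HX_eq_starMatrix_submatrix k)
    (toricHGPCode_HZ_eq_plaquetteMatrix_submatrix k)]
  exact toricCode_dZ

/-- **`d^X = L` EXACTLY for the census toric object, every `L`** (transported from `ToricCode.toricCode_dX`).
[cite: DennisEtAl2002, §3.1 ("the code distance is d = L")] -/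
theorem toricHGPCode_dX_eq (k : ℕ) : (toricHGPCode k).dX = k + 2 := by
  rw [CSSCode.dX_eq_of_submatrix (C := toricCode (k + 2)) (toricHGPCode_HX_eq_starMatrix_submatrix k)
    (toricHGPCode_HZ_eq_plaquetteMatrix_submatrix k)]
  exact toricCode_dX

/-- **The lattice toric code encodes `k = 2` qubits, every `L ≥ 2`** (transported back from Tillich–Zémor Thm 7 for
`HGP(circ_L, circ_L)`, `toricHGPCode_k`). [cite: DennisEtAl2002, §3.1 (two encoded qubits)] [cite: TillichZemor2014, Thm 7] -/
theorem toricCode_k_eq_two (k : ℕ) : (toricCode (k + 2)).k = 2 := by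
  rw [← CSSCode.k_eq_of_submatrix (C := toricCode (k + 2)) (toricHGPCode_HX_eq_starMatrix_submatrix k)
    (toricHGPCode_HZ_eq_plaquetteMatrix_submatrix k)]
  exact toricHGPCode_k k

/-- ★ **The census family B.0 as ONE kernel theorem: `HGP(circ_L, circ_L)` is a `[[2L², 2, L]]` code for EVERY `L ≥ 2`**
(census predicate `CSSCode.IsCode`, exact distance). [cite: KovalevPryadko2012, Example 6 ([[2d², 2, d]])] -/
theorem toricHGPCode_isCode (k : ℕ) : (toricHGPCode k).IsCode (2 * (k + 2) ^ 2) 2 (k + 2) := by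
  refine ⟨?_, toricHGPCode_k k, ?_⟩
  · simp only [Fintype.card_sum, Fintype.card_prod, Fintype.card_fin]
    ring
  · rw [CSSCode.cssMinDist_eq_min_dX_dZ _ (by rw [toricHGPCode_k]; norm_num), toricHGPCode_dX_eq,
      toricHGPCode_dZ_eq, min_self]

/-- **The lattice toric code is a `[[2L², 2, L]]` code for every `L ≥ 2`** (the DKLP object `ToricCode.toricCode`, census
predicate). [cite: DennisEtAl2002, §3.1 (2L² links, k = 2, d = L)] -/
theorem toricCode_isCode (k : ℕ) : (toricCode (k + 2)).IsCode (2 * (k + 2) ^ 2) 2 (k + 2) :=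
  (CSSCode.isCode_iff_of_submatrix (C := toricCode (k + 2)) (toricHGPCode_HX_eq_starMatrix_submatrix k)
    (toricHGPCode_HZ_eq_plaquetteMatrix_submatrix k) _ _ _).1 (toricHGPCode_isCode k)

/-! ### Loss thresholds of the census toric object: EXACTLY `1/2` -/

/-- The `Z`-sector erasure family of `k ↦ HGP(circ_{k+2}, circ_{k+2})` is the lattice loss family shifted by one index
(erasure-uncorrectability is a re-indexing invariant, `CSSCode.uncorrectableProb_reindex`).
[cite: StaceBarrettDoherty2009, p. 2 (loss criterion)] -/
theorem toricHGP_zErasureFamily_eq_erasureFamily (k : ℕ) (y : ℝ) :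
    zErasureFamily (fun k => toricHGPCode k) k y = erasureFamily (k + 1) y := by
  change ErasureDecoder.uncorrectableProb {x | (toricHGPCode k).HX *ᵥ x = 0}
      ((toricHGPCode k).rowSpZ : Set (_ → ZMod 2)) y = _
  rw [toricHGPCode_eq_reindex, CSSCode.uncorrectableProb_reindex]
  rfl

/-- The `X`-sector erasure family of `k ↦ HGP(circ_{k+2}, circ_{k+2})` is the same shifted lattice loss family
(re-indexing + lattice self-duality `ToricCode.uncorrectableProb_dual`). [cite: StaceBarrettDoherty2009, p. 2] -/
theorem toricHGP_xErasureFamily_eq_erasureFamily (k : ℕ) (y : ℝ) :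
    xErasureFamily (fun k => toricHGPCode k) k y = erasureFamily (k + 1) y := by
  change ErasureDecoder.uncorrectableProb {x | (toricHGPCode k).swap.HX *ᵥ x = 0}
      ((toricHGPCode k).swap.rowSpZ : Set (_ → ZMod 2)) y = _
  rw [toricHGPCode_eq_reindex, CSSCode.reindex_swap, CSSCode.uncorrectableProb_reindex]
  exact uncorrectableProb_dual y

/-- Threshold lower bounds are insensitive to an index shift of the family. [folklore] -/
theorem isThresholdLowerBound_succ_iff (P : ℕ → ℝ → ℝ) (p₀ : ℝ) :
    IsThresholdLowerBound (fun i => P (i + 1)) p₀ ↔ IsThresholdLowerBound P p₀ := by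
  unfold IsThresholdLowerBound BelowThreshold
  exact forall₃_congr fun p _ _ => Filter.tendsto_add_atTop_iff_nat (f := fun i => P i p) 1

/-- The accuracy threshold is insensitive to an index shift of the family. [folklore] -/
theorem accuracyThreshold_succ (P : ℕ → ℝ → ℝ) : accuracyThreshold (fun i => P (i + 1)) = accuracyThreshold P := by
  unfold accuracyThreshold thresholdLowerBounds
  simp_rw [isThresholdLowerBound_succ_iff]

/-- The `Z`-sector erasure family of the census toric object, as a shifted family. [cite: StaceBarrettDoherty2009, p. 2] -/
theorem toricHGP_zErasureFamily_eq_erasureFamily' : zErasureFamily (fun k => toricHGPCode k) = fun i => erasureFamily (i + 1) :=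
  funext fun k => funext fun y => toricHGP_zErasureFamily_eq_erasureFamily k y

/-- The `X`-sector erasure family of the census toric object, as a shifted family. [cite: StaceBarrettDoherty2009, p. 2] -/
theorem toricHGP_xErasureFamily_eq_erasureFamily' : xErasureFamily (fun k => toricHGPCode k) = fun i => erasureFamily (i + 1) :=
  funext fun k => funext fun y => toricHGP_xErasureFamily_eq_erasureFamily k y

/-- ★ **Loss threshold of `HGP(circ_L, circ_L)` (`Z`-sector) EXACTLY `1/2`** — the census object of Q5 row F4, whose
certified interval was `1/3 ≤ y_c ≤ 1/2`. [cite: StaceBarrettDoherty2009, p. 1 (abstract: maximum tolerable loss rate 50%)] -/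
theorem toricHGP_z_erasure_accuracyThreshold_eq_half :
    accuracyThreshold (zErasureFamily (fun k => toricHGPCode k)) = 1 / 2 := by
  rw [toricHGP_zErasureFamily_eq_erasureFamily', accuracyThreshold_succ]
  exact erasure_accuracyThreshold_eq_half

/-- ★ **Loss threshold of `HGP(circ_L, circ_L)` (`X`-sector) EXACTLY `1/2`.**
[cite: StaceBarrettDoherty2009, p. 1 (abstract)] -/
theorem toricHGP_x_erasure_accuracyThreshold_eq_half :
    accuracyThreshold (xErasureFamily (fun k => toricHGPCode k)) = 1 / 2 := by
  rw [toricHGP_xErasureFamily_eq_erasureFamily', accuracyThreshold_succ]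
  exact erasure_accuracyThreshold_eq_half

/-- `Z`-sector floor in `IsThresholdLowerBound` form for the census toric object. [cite: StaceBarrettDoherty2009, p. 2–3] -/
theorem toricHGP_z_lossThreshold_half : IsThresholdLowerBound (zErasureFamily (fun k => toricHGPCode k)) (1 / 2) := by
  rw [toricHGP_zErasureFamily_eq_erasureFamily', isThresholdLowerBound_succ_iff]
  exact erasureThreshold_half

/-- `X`-sector floor in `IsThresholdLowerBound` form for the census toric object. [cite: StaceBarrettDoherty2009, p. 2–3] -/
theorem toricHGP_x_lossThreshold_half : IsThresholdLowerBound (xErasureFamily (fun k => toricHGPCode k)) (1 / 2) := by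
  rw [toricHGP_xErasureFamily_eq_erasureFamily', isThresholdLowerBound_succ_iff]
  exact erasureThreshold_half

/-- Supercritical half for the census toric object (both sectors share the family): for `1/2 < y ≤ 1` the
uncorrectability probability tends to `1`. [cite: StaceBarrettDoherty2009, p. 3] -/
theorem toricHGP_z_loss_tendsto_one {y : ℝ} (hy : 1 / 2 < y) (hy1 : y ≤ 1) :
    Tendsto (fun k => zErasureFamily (fun k => toricHGPCode k) k y) atTop (𝓝 1) := by
  simp only [toricHGP_zErasureFamily_eq_erasureFamily]
  exact (Filter.tendsto_add_atTop_iff_nat (f := fun L => erasureFamily L y) 1).2 (tendsto_erasureFamily_one hy hy1)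

end Summit.Ventures.QEC.Thresholds
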